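import Mathlib
import HarnessLib
import HarnessLib.Audit
import Summits.QuantumFields.Statement
import Summits.QuantumFields.YangMills.Theorems.WeakCouplingRates
import Literature.MathematicalPhysics.QuantumLattice.LatticeGaugeDLRSymmetry
import Summits.QuantumFields.YangMills.Theses.SteinGapBootstrap
import Summits.QuantumFields.YangMills.Theorems.SteinGapBootstrapSteinBlockTransferGStubAxisTransport
import Summits.QuantumFields.YangMills.Theorems.SteinGapBootstrapSteinBlockTransferGStubRungUnitRate
import Summits.QuantumFields.YangMills.Theorems.SteinGapBootstrapSteinBlockTransferGOfColdBox

/-!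
# BC3 birth skeleton — crux `SteinBlockTransferG` (rank 2, XL) of route `SteinGapBootstrap` (rev 1, all compact simple `G`)

LINE «all-axes transfer»: the crux's hypotheses (ii) axis symmetry + (iii) time-hyperplane pair clustering are first TRANSPORTED to pair
clustering across every axis hyperplane `{x_i ≤ 0} | {x_i ≥ t}` (`stub_axisTransport`, S/M: `timeReflectLG` is an involution carrying the
closed half `{x₀ ≤ 0}` onto the positive-time edges, `timeShiftLG t` carries `{x₀ ≥ t}` onto them, and the transposition `(0 i) ∈ W₄` acts
on limit states by (ii)); the Stein generator comparison proper is `stub_steinTransferAllAxes` (XL): with small fields (i) and all-axes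
clustering at rate `m`, the Langevin / Schwinger–Dyson generator of the block Wilson measure (block side `R = β^{1/8}`) is compared with
the Ornstein–Uhlenbeck generator of the lattice-Maxwell ⊗ 𝔤 curvature Gaussian field (`Literature…curvatureGaussianField D`,
`D = dim G`): interior mismatch `O(β^{-1/2} R²)` by BCH, boundary mismatch `O(m^{-4} R^{-3})` by clustering, large fields `O(R⁴ C₀/β)`,
Stein factors `O(R²)` — giving the free law `2^{-D}((1 − c_n²)^{-D/2} − 1)` of the probe covariance within `C (1 + m⁻¹ + n)^K β^{-δ}`.
The Stein content stays ONE named stub until the block OU semigroup on plaquette 2-forms is a tree object (definition request filed on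
the crux item); its first interior lemma (OU Stein factors `Σ_e ‖∇_e f_h‖ ≤ C R²`) is the BC5 plan-only rung.

`SteinBlockTransferG_of` composes the two stubs (kernel-checked, no `sorry` outside `stub_*`).

LEAD v3 (2026-08-27T23:10Z): rung `stub_rung_unitRate` landed VACUOUSLY (p583216); structural helpers landed: `…ClusterRate`
(crux ⇐ power-rate bound on the (iii)-clustering rate, free `K, δ`), `…FloorRate` (that bound ⇐ torus plaquette floor; SU(2) instance of
the crux UNCONDITIONAL: `transfer_SU2`), `…OfColdBox` (crux ⇐ all-G BOX ∧ BULK, `SteinBlockTransferG_of_boxBulkAllG`). ONE open stub: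
`stub_steinTransferAllAxes` (XL) — as stated it is likewise implied by the all-G floor; its floor-free content is the Stein programme
(K1a OU Stein factors / K1b Schwinger–Dyson + BCH interior / K1c boundary + Maxwell bias of the route's TWO-LAYER PLAN), crux-sized.

LEAD v2 (2026-08-27T22:50Z): STUB 1 `stub_axisTransport` landed (p581524) and is imported; open stubs: `stub_steinTransferAllAxes` (XL, the
Stein content) and the plan-only rung `stub_rung_unitRate`.

LEAD RESHAPE v1 (prover-ym-line-sgb-k1-g0-0, 2026-08-27): stub STATEMENTS unchanged as terms; the `letI … := borel G; …` body of each stub is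
parenthesised so that the registered stub signature is the whole statement (the skeleton parser cuts a signature at the first
depth-0 `:=`, which truncated every stub of v0 at `letI : MeasurableSpace G`).

The crux decl is imported from the route module `Summits.QuantumFields.YangMills.Theses.SteinGapBootstrap` (rev 1).
-/


namespace Summit.QuantumFields.YangMills.Cruxes.SteinBlockTransferG.AllAxesTransfer

open MeasureTheory

-- STUB 1 `stub_axisTransport` (S/M, axis transport): LANDED — `Theorems/SteinGapBootstrapSteinBlockTransferGStubAxisTransport.lean`
-- (p581524, prover-ym-line-sgb-k1-g0-0); imported above, used BY NAME in `SteinBlockTransferG_of_stubs`.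


/-- STUB 2 (XL) — Stein generator comparison with all-axes clustering: small fields (i) + pair clustering at rate `m` across every axis
hyperplane pin the plaquette-probe covariance at every separation `n ≥ 1` to the free lattice-Maxwell ⊗ 𝔤 law within
`C (1 + m⁻¹ + n)^K β^(−δ)`. [cite: Chatterjee2016] [cite: ChatterjeeMeckes2008] [cite: SeilerLNP1982] -/
theorem stub_steinTransferAllAxes :
    ∀ (G : Type) [Group G] [TopologicalSpace G] [IsTopologicalGroup G] [CompactSpace G], Literature.MathematicalPhysics.QuantumFieldTheory.IsCompactSimpleLieGroup G → (letI : MeasurableSpace G := borel G; haveI : BorelSpace G := ⟨rfl⟩; ∀ r : Literature.MathematicalPhysics.QuantumFieldTheory.LatticeRep G, ∀ C₀ : ℝ, ∃ (K δ C β₀ : ℝ), 0 < δ ∧ 0 < C ∧ ∀ β : ℝ, β₀ ≤ β → ∀ μ ∈ Literature.MathematicalPhysics.QuantumLattice.infiniteVolumeLimitPoints (d := 4) r.ρ β, (∀ (x : Literature.Probability.LatticeModels.Site 4) (i j : Fin 4), i ≠ j → ∫ U, ((r.N : ℝ) - Literature.MathematicalPhysics.QuantumLattice.plaquetteObs r.ρ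 x i j U) ∂μ ≤ C₀ / β) → ∀ m : ℝ, 0 < m → (∀ (i : Fin 4) (t : ℕ) (A B : Literature.MathematicalPhysics.QuantumLattice.LGConfig 4 (G) → ℝ) (SA SB : Finset (Literature.MathematicalPhysics.QuantumLattice.ZdEdge 4)), Literature.MathematicalPhysics.QuantumLattice.IsCylinder A SA → Literature.MathematicalPhysics.QuantumLattice.IsCylinder B SB → Continuous A → Continuous B → (∀ e ∈ SA, e.1 i ≤ 0 ∧ (e.2 = i → e.1 i ≤ -1)) → (∀ e ∈ SB, (t : ℤ) ≤ e.1 i) → ∀ a b : ℝ, (∀ U, |A U| ≤ a) → (∀ U, |B U| ≤ b) → |(∫ U, A U * B U ∂μ) - (∫ U, A U ∂μ) * (∫ U, B U ∂μ)| ≤ 2 * Real.exp (-(m * t)) * a * b) → ∀ n : ℕ, 1 ≤ n → let P : Literature.MathematicalPhysics.QuantumLattice.LGConfig 4 (G) → ℝ := fun U => Real.exp (-2 * max (β * ((r.N : ℝ) - Literature.MathematicalPhysics.QuantumLattice.plaquetteObs r.ρ 0 1 2 U)) 0); let D : ℝ := (Module.finrank ℝ ↥(Submodule.span ℝ {X :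 Matrix (Fin r.N) (Fin r.N) ℂ | ∀ t : ℝ, NormedSpace.exp ((t : ℂ) • X) ∈ Set.range r.ρ}) : ℝ); let c₂ : ℝ := Literature.MathematicalPhysics.QuantumFieldTheory.curvaturePlaquetteCorr (d := 4) (by norm_num) (n : ℤ); |((∫ U, P U * P (Summit.QuantumFields.YangMills.Theorems.WeakCouplingRates.timeShiftLG (G := G) n U) ∂μ) - (∫ U, P U ∂μ) * (∫ U, P (Summit.QuantumFields.YangMills.Theorems.WeakCouplingRates.timeShiftLG (G := G) n U) ∂μ)) - (2 : ℝ) ^ (-D) * ((1 - c₂ ^ 2) ^ (-(D / 2)) - 1)| ≤ C * (1 + m⁻¹ + n) ^ K * β ^ (-δ)) := by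
  sorry

-- BC5 FIRST RUNG `stub_rung_unitRate` (rates `m ≥ 1`): LANDED — `Theorems/SteinGapBootstrapSteinBlockTransferGStubRungUnitRate.lean`
-- (p583216), VACUOUSLY: by the tree's local free-gluon law no torus-limit state clusters at rate ≥ 1 for large β
-- (`eventually_no_unitRate_clustering`); it therefore does not witness the line's lever.


/-- COMPOSITION (kernel-checked): the two stubs give the crux `SteinBlockTransferG` BY NAME. -/
theorem SteinBlockTransferG_of
    (hT : ∀ (G : Type) [Group G] [TopologicalSpace G] [IsTopologicalGroup G] [CompactSpace G], Literature.MathematicalPhysics.QuantumFieldTheory.IsCompactSimpleLieGroup G → letI : MeasurableSpace G := borel G; haveI : BorelSpace G := ⟨rfl⟩; ∀ r : Literature.MathematicalPhysics.QuantumFieldTheory.LatticeRep G, ∀ β : ℝ, ∀ μ ∈ Literature.MathematicalPhysics.QuantumLattice.infiniteVolumeLimitPoints (d := 4) r.ρ β, (∀ (σ : Equiv.Perm (Fin 4)) (F : Literature.MathematicalPhysics.QuantumLattice.LGConfig 4 (G) → ℝ) (S : Finset (Literature.MathematicalPhysics.QuantumLattice.ZdEdge 4)), Literature.MathematicalPhysics.QuantumLattice.IsCylinder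 F S → Continuous F → (∃ C, ∀ U, |F U| ≤ C) → ∫ U, F (Literature.MathematicalPhysics.QuantumLattice.relabelConfig (Literature.MathematicalPhysics.QuantumLattice.edgePerm σ) U) ∂μ = ∫ U, F U ∂μ) → ∀ m : ℝ, 0 < m → (∀ (A B : Literature.MathematicalPhysics.QuantumLattice.LGConfig 4 (G) → ℝ), Summit.QuantumFields.YangMills.Theorems.WeakCouplingRates.IsPosTimeObs A → Summit.QuantumFields.YangMills.Theorems.WeakCouplingRates.IsPosTimeObs B → ∀ a b : ℝ, (∀ U, |A U| ≤ a) → (∀ U, |B U| ≤ b) → ∀ t : ℕ, |(∫ U, A (Summit.QuantumFields.YangMills.Theorems.WeakCouplingRates.timeReflectLG U) * B (Summit.QuantumFields.YangMills.Theorems.WeakCouplingRates.timeShiftLG (G := G) t U) ∂μ) - (∫ U, A (Summit.QuantumFields.YangMills.Theorems.WeakCouplingRates.timeReflectLG U) ∂μ) * (∫ U, B (Summit.QuantumFields.YangMills.Theorems.WeakCouplingRates.timeShiftLG (G := G) t U) ∂μ)| ≤ 2 * Real.exp (-(m * t)) * a * b) → (∀ (i : Fin 4) (t : ℕ) (A B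 : Literature.MathematicalPhysics.QuantumLattice.LGConfig 4 (G) → ℝ) (SA SB : Finset (Literature.MathematicalPhysics.QuantumLattice.ZdEdge 4)), Literature.MathematicalPhysics.QuantumLattice.IsCylinder A SA → Literature.MathematicalPhysics.QuantumLattice.IsCylinder B SB → Continuous A → Continuous B → (∀ e ∈ SA, e.1 i ≤ 0 ∧ (e.2 = i → e.1 i ≤ -1)) → (∀ e ∈ SB, (t : ℤ) ≤ e.1 i) → ∀ a b : ℝ, (∀ U, |A U| ≤ a) → (∀ U, |B U| ≤ b) → |(∫ U, A U * B U ∂μ) - (∫ U, A U ∂μ) * (∫ U, B U ∂μ)| ≤ 2 * Real.exp (-(m * t)) * a * b))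
    (hS : ∀ (G : Type) [Group G] [TopologicalSpace G] [IsTopologicalGroup G] [CompactSpace G], Literature.MathematicalPhysics.QuantumFieldTheory.IsCompactSimpleLieGroup G → letI : MeasurableSpace G := borel G; haveI : BorelSpace G := ⟨rfl⟩; ∀ r : Literature.MathematicalPhysics.QuantumFieldTheory.LatticeRep G, ∀ C₀ : ℝ, ∃ (K δ C β₀ : ℝ), 0 < δ ∧ 0 < C ∧ ∀ β : ℝ, β₀ ≤ β → ∀ μ ∈ Literature.MathematicalPhysics.QuantumLattice.infiniteVolumeLimitPoints (d := 4) r.ρ β, (∀ (x : Literature.Probability.LatticeModels.Site 4) (i j : Fin 4), i ≠ j → ∫ U, ((r.N : ℝ) - Literature.MathematicalPhysics.QuantumLattice.plaquetteObs r.ρ x i j U) ∂μ ≤ C₀ / β) → ∀ m : ℝ, 0 < m → (∀ (i : Fin 4) (t : ℕ) (A B : Literature.MathematicalPhysics.QuantumLattice.LGConfig 4 (G) → ℝ) (SA SB : Finset (Literature.MathematicalPhysics.QuantumLattice.ZdEdge 4)), Literature.MathematicalPhysics.QuantumLattice.IsCylinder A SA → Literature.MathematicalPhysics.QuantumLattice.IsCylinder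 B SB → Continuous A → Continuous B → (∀ e ∈ SA, e.1 i ≤ 0 ∧ (e.2 = i → e.1 i ≤ -1)) → (∀ e ∈ SB, (t : ℤ) ≤ e.1 i) → ∀ a b : ℝ, (∀ U, |A U| ≤ a) → (∀ U, |B U| ≤ b) → |(∫ U, A U * B U ∂μ) - (∫ U, A U ∂μ) * (∫ U, B U ∂μ)| ≤ 2 * Real.exp (-(m * t)) * a * b) → ∀ n : ℕ, 1 ≤ n → let P : Literature.MathematicalPhysics.QuantumLattice.LGConfig 4 (G) → ℝ := fun U => Real.exp (-2 * max (β * ((r.N : ℝ) - Literature.MathematicalPhysics.QuantumLattice.plaquetteObs r.ρ 0 1 2 U)) 0); let D : ℝ := (Module.finrank ℝ ↥(Submodule.span ℝ {X : Matrix (Fin r.N) (Fin r.N) ℂ | ∀ t : ℝ, NormedSpace.exp ((t : ℂ) • X) ∈ Set.range r.ρ}) : ℝ); let c₂ : ℝ := Literature.MathematicalPhysics.QuantumFieldTheory.curvaturePlaquetteCorr (d := 4) (by norm_num) (n : ℤ); |((∫ U, P U * P (Summit.QuantumFields.YangMills.Theorems.WeakCouplingRates.timeShiftLG (G := G) n U)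 ∂μ) - (∫ U, P U ∂μ) * (∫ U, P (Summit.QuantumFields.YangMills.Theorems.WeakCouplingRates.timeShiftLG (G := G) n U) ∂μ)) - (2 : ℝ) ^ (-D) * ((1 - c₂ ^ 2) ^ (-(D / 2)) - 1)| ≤ C * (1 + m⁻¹ + n) ^ K * β ^ (-δ)) :
    Summit.QuantumFields.YangMills.Theses.SteinGapBootstrap.SteinBlockTransferG := by
  intro G _ _ _ _ hG r C₀
  obtain ⟨K, δ, C, β₀, hδ, hC, h⟩ := hS G hG r C₀
  refine ⟨K, δ, C, β₀, hδ, hC, ?_⟩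
  intro β hβ μ hμ hi hii m hm hiii n hn
  exact h β hβ μ hμ hi m hm (hT G hG r β μ hμ hii m hm hiii) n hn

/-- The composition applied to the stubs (sorries live only inside `stub_*`). -/
theorem SteinBlockTransferG_of_stubs : Summit.QuantumFields.YangMills.Theses.SteinGapBootstrap.SteinBlockTransferG :=
  SteinBlockTransferG_of stub_axisTransport stub_steinTransferAllAxes

end Summit.QuantumFields.YangMills.Cruxes.SteinBlockTransferG.AllAxesTransfer
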